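import Literature.AnabelianGeometry.Anabelioids.TerminalCoproductComponents
import HarnessLib

/-!
# Connected objects are preserved and reflected by equivalences of categories

[SGA1] Exp. V §4 (condition (G3)) / [GeoAn] Def. 1.1.1: a connected object of a Galois category
(connected anabelioid) is a non-initial object without non-trivial subobjects (Mathlib
`PreGaloisCategory.IsConnected`).  Mathlib-level plumbing for the abc-iut cell's anabelioid dictionary
(campaign-L R1; seat abc-iut-f-072): an equivalence of categories `e : C ≌ D` PRESERVES and REFLECTS
connected objects (`isConnected_map_equivalence`, `isConnected_iff_of_equivalence`) — equivalences
preserve initial objects and monomorphisms and reflect isomorphisms.  Used to read the connected objects of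
`Cov^fin(X)` off Mathlib's `Action.isConnected_iff_transitive` through `CovFin.galoisCorrespondence`.
Theorems only; nothing here bears on [IUTchIII] Cor. 3.12.
-/

namespace Literature.AnabelianGeometry.Anabelioids

open CategoryTheory CategoryTheory.Limits CategoryTheory.PreGaloisCategory

universe v₁ v₂ u₁ u₂

variable {C : Type u₁} [Category.{v₁} C] {D : Type u₂} [Category.{v₂} D]

/-- **Equivalences preserve connected objects**: if `X` is connected then so is `e.functor.obj X`
(an initial `e X` would make `X ≅ e⁻¹ e X` initial; a mono `Y ↪ e X` from a non-initial `Y` pulls back to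
a mono `e⁻¹ Y ↪ e⁻¹ e X ≅ X` from a non-initial object, an isomorphism by connectedness of `X`, and
`e⁻¹` reflects isomorphisms). [cite: SGA1, Exp. V §4 (condition (G3))] -/
theorem isConnected_map_equivalence (e : C ≌ D) (X : C) [h : IsConnected X] :
    IsConnected (e.functor.obj X) where
  notInitial hI :=
    h.notInitial ((IsInitial.isInitialObj e.inverse _ hI).ofIso (e.unitIso.app X).symm)
  noTrivialComponent Y i _ hY := by
    have hY' : IsInitial (e.inverse.obj Y) → False := fun hI =>
      hY ((IsInitial.isInitialObj e.functor _ hI).ofIso (e.counitIso.app Y))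
    haveI : Mono (e.inverse.map i) := e.inverse.map_mono i
    haveI : Mono (e.inverse.map i ≫ (e.unitIso.app X).inv) := mono_comp _ _
    haveI : IsIso (e.inverse.map i ≫ (e.unitIso.app X).inv) :=
      h.noTrivialComponent _ (e.inverse.map i ≫ (e.unitIso.app X).inv) hY'
    haveI : IsIso (e.inverse.map i) :=
      IsIso.of_isIso_comp_right (e.inverse.map i) (e.unitIso.app X).inv
    exact isIso_of_reflects_iso i e.inverse

/-- **Connectedness is invariant under equivalence**: `X` is connected iff `e.functor.obj X` is.
[cite: SGA1, Exp. V §4 (condition (G3))] -/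
theorem isConnected_iff_of_equivalence (e : C ≌ D) (X : C) :
    IsConnected X ↔ IsConnected (e.functor.obj X) := by
  refine ⟨fun _ => isConnected_map_equivalence e X, fun h => ?_⟩
  haveI : IsConnected ((e.functor ⋙ e.inverse).obj X) :=
    isConnected_map_equivalence e.symm (e.functor.obj X)
  exact isConnected_of_iso (e.unitIso.app X).symm

end Literature.AnabelianGeometry.Anabelioids
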